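import Summits.BirchSwinnertonDyer.Rank1Residual.X11b.FrameSeparation
import Summits.BirchSwinnertonDyer.Rank1Residual.X11b.FrameMahlerBound
import Summits.BirchSwinnertonDyer.Rank1Residual.X11b.IntSeriesValueRigidity
import HarnessLib

/-!
# X11b — the RIGIDITY KERNEL: two elements `Q, Q' ∈ 𝓞_{ℂ_p}⟦T⟧` whose values along the powers of
# a principal unit `x` are tied by `Q'(x^j − 1) = b^j·Q(x^j − 1)` BOTH VANISH unless `b` is
# adherent to `x^ℤ`

HONEST FRAMING (cell `b2b-bsdres`, run/shared/lean/b2b/bsd-rank1-residual/, verbatim in every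
file): the goal of the cell is to DELETE the COMBINATION-SHAPED residual classes of the
Birch–Swinnerton-Dyer formula for ALL analytic-rank `≤ 1` elliptic curves over `ℚ` — "full BSD
formula for every rank `≤ 1` curve in class `C`" assembled STRICTLY from published theorems — so
that the rank-`≤ 1` remainder becomes exactly the CONSTRUCTION-SHAPED classes, which are TYPED
(missing-input `Prop`s), NOT attempted. This is not "finishing BSD". Sub-cell
`b2b-bsdres-multr1-p1` (X11b, route R1, gen 25); THEOREMS ONLY (elementary `p`-adic analysis; no
definition, no named fact, no `sorry`); valid at every prime `p`; nothing here changes a label.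

## Why this file (step III-a of IDEAL RIGIDITY ACROSS PERIODS, INTENT HOME/INBOX.md 2026-08-21)

Two BDP frames of the same `(ι, 𝔭, κ, γ, f)` with different periods give exactly the situation of
the title (`x` = the avatar value of an interpolation character at `γ`, `b` = the period ratio to the
weight). This file proves the analytic heart:

* **`R1.value_eq_zero_of_separated`** — if `Q(x^j − 1) = V_j`, `Q'(x^j − 1) = V'_j` with
  `V'_j = b^j V_j` for `j ≥ 1`, `b ≠ 0`, `‖x − 1‖ < p⁻¹`, and `‖b − x^n‖ ≥ δ > 0` for every `n : ℤ`, then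
  `V_j = 0` for all `j ≥ 1`: test the value functionals against `H = G·X^{i+1}` and
  `H₂ = (G − 1)·X^{i+1}` for the separating polynomials `G` of step II-b (`≈ 0` on `{x^k}`, `≈ 1` on
  `{b x^k}`) and use the Mahler bound of step I on both sides;
* **`R1.eq_zero_of_separated`** — hence `Q = 0` (and `Q' = 0`) by the identity principle along
  `x^{p^k} − 1 → 0` (`x ≠ 1`), gen 23's `R1.intSeries_eq_of_hasValueAt`.

References: [Washington1997] §5.1; [Cassels1986] Ch. 4 (Strassmann / identity principle).
-/

noncomputable section

open scoped Classical Topology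
open Filter Finset Polynomial
open Literature.NumberTheory.EllipticCurves

namespace Summit.BirchSwinnertonDyer.Rank1Residual.X11b

variable {p : ℕ} [Fact p.Prime]

/-! ### §1 The Mahler bound in polynomial form -/

/-- **Mahler bound, polynomial form**: `‖Σ_{j<D} H_j V_j‖ ≤ B` whenever `Q(x^j − 1) = V_j` for all
`j` and `‖H(x^k)‖ ≤ B` for all `k` (`H ∈ ℂ_p[X]` with `natDegree H < D`). [cite: Washington1997, §5.1] -/
theorem R1.norm_sum_coeff_mul_value_le {Q : PowerSeries 𝓞_ℂ_[p]} {x : ℂ_[p]} {V : ℕ → ℂ_[p]}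
    (hV : ∀ j, IntSeries.HasValueAt Q (x ^ j - 1) (V j)) (H : ℂ_[p][X]) {D : ℕ}
    (hD : H.natDegree < D) {B : ℝ} (hB0 : 0 ≤ B) (hB : ∀ k : ℕ, ‖H.eval (x ^ k)‖ ≤ B) :
    ‖∑ j ∈ range D, H.coeff j * V j‖ ≤ B := by
  refine R1.norm_sum_mul_value_le (fun j => H.coeff j) D (fun j _ => hV j) hB0 fun k => ?_
  rw [← eval_eq_sum_range' hD]
  exact hB k

/-- **Mahler bound, polynomial form, translated test points**: `‖Σ_{j<D} H_j b^j V_j‖ ≤ B` whenever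
`‖H(b·x^k)‖ ≤ B` for all `k`. [cite: Washington1997, §5.1] -/
theorem R1.norm_sum_coeff_mul_pow_mul_value_le {Q : PowerSeries 𝓞_ℂ_[p]} {x : ℂ_[p]}
    {V : ℕ → ℂ_[p]} (hV : ∀ j, IntSeries.HasValueAt Q (x ^ j - 1) (V j)) (H : ℂ_[p][X]) (b : ℂ_[p])
    {D : ℕ} (hD : H.natDegree < D) {B : ℝ} (hB0 : 0 ≤ B) (hB : ∀ k : ℕ, ‖H.eval (b * x ^ k)‖ ≤ B) :
    ‖∑ j ∈ range D, H.coeff j * b ^ j * V j‖ ≤ B := by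
  refine R1.norm_sum_mul_pow_mul_value_le (fun j => H.coeff j) b D (fun j _ => hV j) hB0 fun k => ?_
  rw [← eval_eq_sum_range' hD]
  exact hB k

/-! ### §2 Vanishing of the values under separation -/

/-- **The values vanish under separation.** Let `Q, Q' ∈ 𝓞_{ℂ_p}⟦T⟧`, `x ∈ ℂ_p` with
`‖x − 1‖ < p⁻¹`, `b ≠ 0`, values `Q(x^j − 1) = V_j`, `Q'(x^j − 1) = V'_j` with `V'_j = b^j V_j` for
`j ≥ 1`, and suppose `‖b − x^n‖ ≥ δ > 0` for every `n : ℤ`. Then `V_j = 0` for every `j ≥ 1`.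
Proof: for the separating polynomial `G` of `R1.exists_separating_polynomial` (`‖G(x^k)‖ ≤ ε`,
`‖G(b x^k) − 1‖ ≤ ε`) and `H = G·X^{i+1}`, `H₂ = (G − 1)·X^{i+1}`: the Mahler bound gives
`‖Σ H_j V'_j‖ ≤ ε` and `‖Σ (H₂)_j b^j V_j‖ ≤ ε‖b‖^{i+1}`, while
`Σ H_j V'_j − Σ (H₂)_j b^j V_j = b^{i+1} V_{i+1}`; let `ε → 0`. [cite: Washington1997, §5.1] -/
theorem R1.value_eq_zero_of_separated {Q Q' : PowerSeries 𝓞_ℂ_[p]} {x b : ℂ_[p]} {δ : ℝ}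
    {V V' : ℕ → ℂ_[p]} (hx : ‖x - 1‖ < (p : ℝ)⁻¹) (hb : b ≠ 0) (hδ0 : 0 < δ)
    (hδ : ∀ n : ℤ, δ ≤ ‖b - x ^ n‖) (hV : ∀ j, IntSeries.HasValueAt Q (x ^ j - 1) (V j))
    (hV' : ∀ j, IntSeries.HasValueAt Q' (x ^ j - 1) (V' j)) (hrel : ∀ j, 0 < j → V' j = b ^ j * V j)
    (i : ℕ) : V (i + 1) = 0 := by
  -- it suffices to bound `‖b^{i+1} V_{i+1}‖` by `ε (1 + ‖b‖^{i+1})` for every `ε > 0`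
  suffices h : ∀ ε : ℝ, 0 < ε → ‖b ^ (i + 1) * V (i + 1)‖ ≤ ε * (1 + ‖b‖ ^ (i + 1)) by
    have hzero : ‖b ^ (i + 1) * V (i + 1)‖ ≤ 0 := by
      refine le_of_forall_pos_le_add fun ε hε => ?_
      have hpos : 0 < 1 + ‖b‖ ^ (i + 1) := by positivity
      have := h (ε / (1 + ‖b‖ ^ (i + 1))) (div_pos hε hpos)
      rw [div_mul_cancel₀ _ hpos.ne'] at this
      linarith
    have hbV : b ^ (i + 1) * V (i + 1) = 0 := norm_le_zero_iff.mp hzero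
    rcases mul_eq_zero.mp hbV with h0 | h0
    · exact absurd h0 (pow_ne_zero _ hb)
    · exact h0
  intro ε hε
  obtain ⟨G, hGx, hGb⟩ := R1.exists_separating_polynomial hx hδ0 hδ hε
  -- the test polynomials
  set H : ℂ_[p][X] := G * X ^ (i + 1) with hH
  set H₂ : ℂ_[p][X] := (G - 1) * X ^ (i + 1) with hH₂
  set D : ℕ := max H.natDegree H₂.natDegree + (i + 2) with hDdef
  have hD : H.natDegree < D := by rw [hDdef]; omega
  have hD₂ : H₂.natDegree < D := by rw [hDdef]; omega
  have hiD : i + 1 < D := by rw [hDdef]; omega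
  have hb1 : ‖b‖ ^ (i + 1) * 1 = ‖b‖ ^ (i + 1) := mul_one _
  -- (a) `‖Σ H_j V'_j‖ ≤ ε`
  have ha : ‖∑ j ∈ range D, H.coeff j * V' j‖ ≤ ε := by
    refine R1.norm_sum_coeff_mul_value_le hV' H hD hε.le fun k => ?_
    rw [hH, eval_mul, eval_pow, eval_X, norm_mul, norm_pow, norm_pow,
      R1.norm_eq_one_of_norm_sub_one_lt (hx.trans_le (inv_le_one_of_one_le₀
        (by exact_mod_cast (Fact.out : p.Prime).one_lt.le))), one_pow, one_pow, mul_one]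
    exact hGx k
  -- (b) `‖Σ (H₂)_j b^j V_j‖ ≤ ε ‖b‖^{i+1}`
  have hb' : ‖∑ j ∈ range D, H₂.coeff j * b ^ j * V j‖ ≤ ε * ‖b‖ ^ (i + 1) := by
    refine R1.norm_sum_coeff_mul_pow_mul_value_le hV H₂ b hD₂ (by positivity) fun k => ?_
    rw [hH₂, eval_mul, eval_sub, eval_one, eval_pow, eval_X, norm_mul, mul_pow, norm_mul, norm_pow,
      norm_pow, norm_pow, R1.norm_eq_one_of_norm_sub_one_lt (hx.trans_le (inv_le_one_of_one_le₀
        (by exact_mod_cast (Fact.out : p.Prime).one_lt.le)))]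
    simp only [one_pow, mul_one]
    exact mul_le_mul_of_nonneg_right (hGb k) (by positivity)
  -- (c) the two sums differ by `b^{i+1} V_{i+1}`
  have hrelsum : ∑ j ∈ range D, H.coeff j * V' j = ∑ j ∈ range D, H.coeff j * b ^ j * V j := by
    refine sum_congr rfl fun j _ => ?_
    rcases Nat.eq_zero_or_pos j with rfl | hj
    · -- `H_0 = 0`
      have : H.coeff 0 = 0 := by rw [hH, coeff_mul_X_pow', if_neg (by omega)]
      rw [this, zero_mul, zero_mul, zero_mul]
    · rw [hrel j hj, mul_assoc]
  have hdiff : ∑ j ∈ range D, H.coeff j * b ^ j * V j - ∑ j ∈ range D, H₂.coeff j * b ^ j * V j =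
      b ^ (i + 1) * V (i + 1) := by
    rw [← sum_sub_distrib]
    have hcoeff : ∀ j, H.coeff j - H₂.coeff j = if j = i + 1 then 1 else 0 := by
      intro j
      have : H - H₂ = X ^ (i + 1) := by rw [hH, hH₂]; ring
      rw [← coeff_sub, this, coeff_X_pow]
    have hterm : ∀ j ∈ range D, H.coeff j * b ^ j * V j - H₂.coeff j * b ^ j * V j =
        if j = i + 1 then b ^ (i + 1) * V (i + 1) else 0 := by
      intro j _
      rw [← sub_mul, ← sub_mul, hcoeff j]
      split_ifs with h
      · rw [h, one_mul]
      · rw [zero_mul, zero_mul]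
    rw [sum_congr rfl hterm, sum_ite_eq' (range D) (i + 1), if_pos (mem_range.mpr hiD)]
  -- conclude
  calc ‖b ^ (i + 1) * V (i + 1)‖
      = ‖∑ j ∈ range D, H.coeff j * V' j - ∑ j ∈ range D, H₂.coeff j * b ^ j * V j‖ := by
        rw [hrelsum, hdiff]
    _ ≤ max ‖∑ j ∈ range D, H.coeff j * V' j‖ ‖∑ j ∈ range D, H₂.coeff j * b ^ j * V j‖ := by
        rw [sub_eq_add_neg, ← norm_neg (∑ j ∈ range D, H₂.coeff j * b ^ j * V j)]
        exact IsUltrametricDist.norm_add_le_max _ _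
    _ ≤ max ε (ε * ‖b‖ ^ (i + 1)) := max_le_max ha hb'
    _ ≤ ε * (1 + ‖b‖ ^ (i + 1)) := by
        refine max_le ?_ ?_ <;> nlinarith [norm_nonneg b, pow_nonneg (norm_nonneg b) (i + 1)]

/-! ### §3 Both elements vanish -/

/-- **Under separation, `Q = 0`.** With the hypotheses of `R1.value_eq_zero_of_separated` and
`x ≠ 1`: all values `Q(x^j − 1)`, `j ≥ 1`, vanish, and `x^{p^k} − 1 → 0` without being `0`, so
`Q = 0` by the identity principle (gen 23's `R1.intSeries_eq_of_hasValueAt`).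
[cite: Cassels1986, Ch. 4 Thm. 4.1 (Strassmann; bounded variant via isolated zeros)] -/
theorem R1.eq_zero_of_separated {Q Q' : PowerSeries 𝓞_ℂ_[p]} {x b : ℂ_[p]} {δ : ℝ}
    {V V' : ℕ → ℂ_[p]} (hx : ‖x - 1‖ < (p : ℝ)⁻¹) (hx1 : x ≠ 1) (hb : b ≠ 0) (hδ0 : 0 < δ)
    (hδ : ∀ n : ℤ, δ ≤ ‖b - x ^ n‖) (hV : ∀ j, IntSeries.HasValueAt Q (x ^ j - 1) (V j))
    (hV' : ∀ j, IntSeries.HasValueAt Q' (x ^ j - 1) (V' j)) (hrel : ∀ j, 0 < j → V' j = b ^ j * V j) :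
    Q = 0 := by
  have hp : p.Prime := Fact.out
  have hp1' : (p : ℝ)⁻¹ < 1 := inv_lt_one_of_one_lt₀ (by exact_mod_cast hp.one_lt)
  have hzero : ∀ j, 0 < j → V j = 0 := by
    intro j hj
    obtain ⟨i, rfl⟩ : ∃ i, j = i + 1 := ⟨j - 1, by omega⟩
    exact R1.value_eq_zero_of_separated hx hb hδ0 hδ hV hV' hrel i
  -- the null sequence `x^{p^k} − 1`
  have hlim : Tendsto (fun k : ℕ ↦ x ^ p ^ k - 1) atTop (𝓝 0) := by
    have h := (tendsto_pow_prime_pow_padicComplex (p := p) (hx.trans hp1')).sub_const 1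
    rwa [sub_self] at h
  have hne : ∃ᶠ k in atTop, x ^ p ^ k - 1 ≠ 0 := by
    refine Frequently.of_forall fun k h => hx1 ?_
    have hk : ‖x ^ p ^ k - 1‖ = ((p : ℝ)⁻¹) ^ k * ‖x - 1‖ := R1.norm_pow_prime_pow_sub_one hx k
    rw [h, norm_zero] at hk
    have : ‖x - 1‖ = 0 := by
      have hpk : 0 < ((p : ℝ)⁻¹) ^ k := pow_pos (inv_pos.mpr (by exact_mod_cast hp.pos)) k
      nlinarith [norm_nonneg (x - 1)]
    exact sub_eq_zero.mp (norm_eq_zero.mp this)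
  refine R1.intSeries_eq_of_hasValueAt (x := fun k => x ^ p ^ k - 1) (v := fun _ => 0) hlim hne
    (fun k => ?_) (fun k => intSeries_hasValueAt_zero_series _)
  have h := hV (p ^ k)
  rwa [hzero (p ^ k) (pow_pos hp.pos k)] at h

/-- **Under separation, `Q' = 0` too** (its values at `x^j − 1`, `j ≥ 1`, are `b^j · 0`).
[cite: Cassels1986, Ch. 4 Thm. 4.1 (Strassmann; bounded variant via isolated zeros)] -/
theorem R1.eq_zero_of_separated' {Q Q' : PowerSeries 𝓞_ℂ_[p]} {x b : ℂ_[p]} {δ : ℝ}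
    {V V' : ℕ → ℂ_[p]} (hx : ‖x - 1‖ < (p : ℝ)⁻¹) (hx1 : x ≠ 1) (hb : b ≠ 0) (hδ0 : 0 < δ)
    (hδ : ∀ n : ℤ, δ ≤ ‖b - x ^ n‖) (hV : ∀ j, IntSeries.HasValueAt Q (x ^ j - 1) (V j))
    (hV' : ∀ j, IntSeries.HasValueAt Q' (x ^ j - 1) (V' j)) (hrel : ∀ j, 0 < j → V' j = b ^ j * V j) :
    Q' = 0 := by
  have hp : p.Prime := Fact.out
  have hp1' : (p : ℝ)⁻¹ < 1 := inv_lt_one_of_one_lt₀ (by exact_mod_cast hp.one_lt)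
  have hzero : ∀ j, 0 < j → V' j = 0 := by
    intro j hj
    obtain ⟨i, rfl⟩ : ∃ i, j = i + 1 := ⟨j - 1, by omega⟩
    rw [hrel _ hj, R1.value_eq_zero_of_separated hx hb hδ0 hδ hV hV' hrel i, mul_zero]
  have hlim : Tendsto (fun k : ℕ ↦ x ^ p ^ k - 1) atTop (𝓝 0) := by
    have h := (tendsto_pow_prime_pow_padicComplex (p := p) (hx.trans hp1')).sub_const 1
    rwa [sub_self] at h
  have hne : ∃ᶠ k in atTop, x ^ p ^ k - 1 ≠ 0 := by
    refine Frequently.of_forall fun k h => hx1 ?_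
    have hk : ‖x ^ p ^ k - 1‖ = ((p : ℝ)⁻¹) ^ k * ‖x - 1‖ := R1.norm_pow_prime_pow_sub_one hx k
    rw [h, norm_zero] at hk
    have : ‖x - 1‖ = 0 := by
      have hpk : 0 < ((p : ℝ)⁻¹) ^ k := pow_pos (inv_pos.mpr (by exact_mod_cast hp.pos)) k
      nlinarith [norm_nonneg (x - 1)]
    exact sub_eq_zero.mp (norm_eq_zero.mp this)
  refine R1.intSeries_eq_of_hasValueAt (x := fun k => x ^ p ^ k - 1) (v := fun _ => 0) hlim hne
    (fun k => ?_) (fun k => intSeries_hasValueAt_zero_series _)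
  have h := hV' (p ^ k)
  rwa [hzero (p ^ k) (pow_pos hp.pos k)] at h

end Summit.BirchSwinnertonDyer.Rank1Residual.X11b

end
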